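import Literature.MathematicalPhysics.QuantumChemistry.VariationalRDMRelaxation
import HarnessLib

/-!
# Ventures/CertifiedQuantumChemistry — Rows/GMatrixRelaxationKernel.lean: at EVERY feasible point of
# the printed `S_z`-sector DQG programme `G z′ = 0`, and the kernel rows are the cell's spin-resolved
# contraction rows E2 (rdm-A, addendum 18, theorem F3.2 — relaxation level)

HONEST FRAMING (verbatim): certified bounds for a stated model Hamiltonian in a stated basis; not a
claim about the real molecule beyond that model.

Seat rdm-A (gen 54), zero compute; ROWS courtesy file (no row, no claim node, no certificate sentence,
nothing asserted about any model; no instance, reader or FORMAT byte changes). Companion of rdm-B's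
STATE-level `Rows/GMatrixSectorKernel.lean` (face F1 of `pub-qchem-rdm/FORMAT-qcl1-addendum-17-faces.md`,
`²G(ψ) z′ = 0` for a sector VECTOR `ψ`), whose docstring leaves "the ROW-IMPLIED (relaxation-level)
version" to rdm-A. This is it: rdm-A's THEOREM F3.2 (`pub-qchem-rdm/FORMAT-qcl1-addendum-18-f3.md`
§18.2, there verified in exact rational arithmetic on the `k = 4, 5, 6` layouts only) for EVERY
orbital set `Λ` and sector `(N_α, N_β) = (a, b)`, over the tree's PRINTED sector programme
`IsDQGFeasibleSector a b γ Γ` (`D, Q, G ⪰ 0`, Hermiticity, `Tr γ = N`, spin-free contraction,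
antisymmetry, `S_z` selection rule of `γ`, `Tr γ_αα = a`, `Tr γ_ββ = b`, traces of the `αα/ββ/αβ`
blocks of `Γ`: Mazziotti (2007) §II.F eqs. (87)–(90); Nakata et al. (2008) condition types (4)–(5)),
with `z′ = b Σ_x e_{(xα,xα)} − a Σ_x e_{(xβ,xβ)}` (the SAME lambda term as rdm-B's file) and
Mazziotti's `G`-map `gMap γ Γ` (eq. (15)):
* `sectorVec_dotProduct_gMap_mulVec_sectorVec_eq_zero` (F3.2, identity): `z′† G z′ =
  b² Tr γ_αα + a² Tr γ_ββ + b² Tr Γ_αα + a² Tr Γ_ββ − 2ab Tr Γ_αβ = ab² + a²b + b²a(a−1) + a²b(b−1)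
  − 2a²b² = 0` (antisymmetry moves `G`'s entries onto the block diagonals; in words the printed rows
  say `Var(b N̂_α − a N̂_β) = 0`);
* `gMap_mulVec_sectorVec_eq_zero` (F3.2, kernel = face F1 at RELAXATION level): `G ⪰ 0` turns the
  zero form into `G(γ, Γ) z′ = 0` (`Matrix.PosSemidef.dotProduct_mulVec_zero_iff`) at every feasible
  point, not only at `N`-representable ones; `gMap_sectorKernel_row` writes the rows out;
* `sum_two_upUp/upDown/downDown/downUp_of_isDQGFeasibleSector` (F3.2, rows): for `a + b ≠ 0` the
  kernel rows and the spin-free contraction SOLVE to the E2 rows of `pub-qchem-rdm/FORMAT-qcl1.md` §5,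
  `Σ_y Γ_{(P, yτ),(qσ, yτ)} = (N_τ − [τ = σ]) γ_{P, qσ}`, all four `(σ, τ)` families (names
  `sum_two_<σ><τ>`; any row label `P`): E2 is IMPLIED by the printed programme;
* `isDQGFeasibleSector_of_spinContract` (converse: E1 + E2 at `p = q`, summed, give the block traces)
  and `isDQGFeasibleSector_iff_spinContract` (`a + b ≠ 0`): printed rows ⟺ selection rule + E1 + E2 —
  the two row sets cut out THE SAME subset of `IsDQGFeasible (a + b)` (addendum 18 §18.4 corollary,
  DQG rung, `G` part), hence equal optima for every objective, in exact arithmetic and at the level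
  of these predicates (FORMAT emits the `p ≤ q` half; `(q, p)` is the conjugate row);
* `le_sectorGroundEnergy_of_forall_spinContract`: the cell-row form of the tree's
  `le_sectorGroundEnergy_of_forall_isDQGFeasibleSector`, for EVERY sector (via the sector ground
  state and `sum_twoRDM_orb_up/_down`; no `a + b ≠ 0`).
Words only: `z′ ≠ 0` once `Λ` is inhabited and `(a, b) ≠ (0, 0)` (its `(xα,xα)` entry is `b`, its
`(xβ,xβ)` entry `−a`), so the printed programme's `G` block has no positive-definite feasible point —
primal strict feasibility fails at the level of the ROWS; the E1/E2 counterpart of FORMAT-qcl1 §5's REDUNDANCY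
LEMMA for E3/E4 (cf. "eliminating some of the degeneracies in the system", Fukuda et al., Math.
Program. B 109 (2007) 553, report version B-413, corpus `doi-10-1007-s10107-006-0027-y` PDF p. 22).
Everything is PROVED (0 sorry, 0 def). NOT here: F3.3 / F3.4 (the `G_ab` kernel = the E4 rows) and
the `T2′` border kernel F2 at relaxation level.

References: D. A. Mazziotti, *Variational two-electron reduced-density-matrix theory*, Adv. Chem.
Phys. 134 (Wiley, 2007) 21–59, §II.B eqs. (15)–(16), §II.F eqs. (87)–(90). [cite: Mazziotti2007RDMChapter, §II.B eq. (15)-(16), §II.F eqs. (87)-(90)]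
M. Nakata, B. J. Braams, K. Fujisawa, M. Fukuda, J. K. Percus, M. Yamashita, Z. Zhao, J. Chem. Phys.
128 (2008) 164113, p. 164113-5, condition types (1)–(7) ((4) `N` rows, (5) `N_α` rows; corpus
`doi-10-1063-1-2911696` p. 6). [cite: NakataEtAl2008, p. 164113-5 condition types (1)-(7)]
-/

noncomputable section

namespace Summit.Ventures.CertifiedQuantumChemistry

open Matrix Finset
open Literature.MathematicalPhysics.QuantumLattice Literature.MathematicalPhysics.QuantumChemistry

variable {Λ : Type*} [LinearOrder Λ] [Fintype Λ]

/-! ### Bookkeeping: spin-split sums, the pairing with `z′`, the diagonal column sums of `G` -/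

omit [LinearOrder Λ] in
/-- A sum over the spin orbitals `Orb Λ = Λ ×ₗ Fin 2`, split by spin. [folklore] -/
private theorem sum_orb_eq {M : Type*} [AddCommMonoid M] (F : Orb Λ → M) :
    ∑ P, F P = ∑ p, (F (orb p 0) + F (orb p 1)) := by
  have h : ∑ P, F P = ∑ p, ∑ σ : Fin 2, F (orb p σ) := by
    rw [← Fintype.sum_prod_type' (fun p (σ : Fin 2) => F (orb p σ))]
    exact Fintype.sum_equiv ofLex _ _ fun _ => rfl
  rw [h]
  exact Finset.sum_congr rfl fun p _ => Fin.sum_univ_two _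

omit [LinearOrder Λ] in
/-- Antisymmetry in the column pair turns a "crossed" double block sum into minus a block trace. -/
private theorem sum_sum_swap_snd {Γ : Matrix (Orb Λ × Orb Λ) (Orb Λ × Orb Λ) ℂ}
    (hΓ : ∀ p k l, Γ p (l, k) = -Γ p (k, l)) (f g : Λ → Orb Λ) :
    ∑ x, ∑ y, Γ (f x, g y) (g y, f x) = -∑ x, ∑ y, Γ (f x, g y) (f x, g y) := by
  simp only [← Finset.sum_neg_distrib]
  exact Finset.sum_congr rfl fun x _ => Finset.sum_congr rfl fun y _ => hΓ _ _ _

/-- `z′ · w = Σ_x (b w_{(xα,xα)} − a w_{(xβ,xβ)})` for rdm-A's `z′ = b Σ_x e_{(xα,xα)} − a Σ_x e_{(xβ,xβ)}`. -/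
theorem sectorVec_dotProduct (a b : ℕ) (w : Orb Λ × Orb Λ → ℂ) :
    (fun J : Orb Λ × Orb Λ =>
        ∑ x : Λ, ((if J = (orb x 0, orb x 0) then (b : ℂ) else 0) -
          (if J = (orb x 1, orb x 1) then (a : ℂ) else 0))) ⬝ᵥ w =
      ∑ x : Λ, ((b : ℂ) * w (orb x 0, orb x 0) - (a : ℂ) * w (orb x 1, orb x 1)) := by
  rw [dotProduct]
  calc ∑ J, (∑ x : Λ, ((if J = (orb x 0, orb x 0) then (b : ℂ) else 0) -
            (if J = (orb x 1, orb x 1) then (a : ℂ) else 0))) * w J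
      = ∑ x : Λ, ∑ J, ((if J = (orb x 0, orb x 0) then (b : ℂ) else 0) -
            (if J = (orb x 1, orb x 1) then (a : ℂ) else 0)) * w J := by
        simp only [Finset.sum_mul]
        rw [Finset.sum_comm]
    _ = ∑ x : Λ, ((b : ℂ) * w (orb x 0, orb x 0) - (a : ℂ) * w (orb x 1, orb x 1)) := by
        refine Finset.sum_congr rfl fun x _ => ?_
        simp only [sub_mul, ite_mul, zero_mul, Finset.sum_sub_distrib, Finset.sum_ite_eq',
          Finset.mem_univ, if_true]

/-- The vector `z′` is REAL: `star z′ = z′`. -/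
theorem star_sectorVec (a b : ℕ) :
    star (fun J : Orb Λ × Orb Λ =>
        ∑ x : Λ, ((if J = (orb x 0, orb x 0) then (b : ℂ) else 0) -
          (if J = (orb x 1, orb x 1) then (a : ℂ) else 0))) =
      (fun J : Orb Λ × Orb Λ =>
        ∑ x : Λ, ((if J = (orb x 0, orb x 0) then (b : ℂ) else 0) -
          (if J = (orb x 1, orb x 1) then (a : ℂ) else 0))) := by
  funext J
  simp only [Pi.star_apply, star_sum, star_sub, apply_ite (star : ℂ → ℂ), star_natCast, star_zero]

/-- `G(γ, Γ) z′` componentwise: `(G z′)_I = b Σ_x G_{I,(xα,xα)} − a Σ_x G_{I,(xβ,xβ)}`. -/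
theorem gMap_mulVec_sectorVec_apply (γ : Matrix (Orb Λ) (Orb Λ) ℂ)
    (Γ : Matrix (Orb Λ × Orb Λ) (Orb Λ × Orb Λ) ℂ) (a b : ℕ) (I : Orb Λ × Orb Λ) :
    (gMap γ Γ *ᵥ fun J : Orb Λ × Orb Λ =>
        ∑ x : Λ, ((if J = (orb x 0, orb x 0) then (b : ℂ) else 0) -
          (if J = (orb x 1, orb x 1) then (a : ℂ) else 0))) I =
      (b : ℂ) * ∑ x : Λ, gMap γ Γ I (orb x 0, orb x 0) -
        (a : ℂ) * ∑ x : Λ, gMap γ Γ I (orb x 1, orb x 1) := by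
  rw [mulVec, dotProduct]
  calc ∑ J, gMap γ Γ I J *
          ∑ x : Λ, ((if J = (orb x 0, orb x 0) then (b : ℂ) else 0) -
            (if J = (orb x 1, orb x 1) then (a : ℂ) else 0))
      = ∑ x : Λ, ∑ J, gMap γ Γ I J *
          ((if J = (orb x 0, orb x 0) then (b : ℂ) else 0) -
            (if J = (orb x 1, orb x 1) then (a : ℂ) else 0)) := by
        simp only [Finset.mul_sum]
        rw [Finset.sum_comm]
    _ = ∑ x : Λ, ((b : ℂ) * gMap γ Γ I (orb x 0, orb x 0) -
          (a : ℂ) * gMap γ Γ I (orb x 1, orb x 1)) := by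
        refine Finset.sum_congr rfl fun x _ => ?_
        simp only [mul_sub, mul_ite, mul_zero, Finset.sum_sub_distrib, Finset.sum_ite_eq',
          Finset.mem_univ, if_true]
        ring
    _ = (b : ℂ) * ∑ x : Λ, gMap γ Γ I (orb x 0, orb x 0) -
          (a : ℂ) * ∑ x : Λ, gMap γ Γ I (orb x 1, orb x 1) := by
        rw [Finset.sum_sub_distrib, Finset.mul_sum, Finset.mul_sum]

/-- The column sums of `G(γ, Γ)` over the diagonal spin-`σ` members, from Mazziotti's eq. (15)
`G^{ij}_{kl} = δ_{jl} γ^i_k − Γ^{il}_{kj}`: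
`Σ_x G_{(P, qτ),(xσ, xσ)} = δ_{τσ} γ_{P, qτ} − Σ_x Γ_{(P, xσ),(xσ, qτ)}`. -/
theorem sum_gMap_apply_diag (γ : Matrix (Orb Λ) (Orb Λ) ℂ)
    (Γ : Matrix (Orb Λ × Orb Λ) (Orb Λ × Orb Λ) ℂ) (P : Orb Λ) (q : Λ) (τ σ : Fin 2) :
    ∑ x : Λ, gMap γ Γ (P, orb q τ) (orb x σ, orb x σ) =
      (if τ = σ then γ P (orb q τ) else 0) - ∑ x : Λ, Γ (P, orb x σ) (orb x σ, orb q τ) := by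
  simp only [gMap, Finset.sum_sub_distrib, orb_inj]
  congr 1
  by_cases h : τ = σ
  · subst h
    simp only [and_true, if_true, Finset.sum_ite_eq, Finset.mem_univ]
  · simp only [h, and_false, if_false, Finset.sum_const_zero]

/-! ### F3.2: the form of `G` on `z′` vanishes on the printed rows; `G ⪰ 0` makes `z′` a kernel vector -/

/-- **Theorem F3.2 (identity part; rdm-A addendum 18 §18.2).** At every feasible point of the printed
`S_z`-sector DQG programme the quadratic form of the `G` matrix on
`z′ = b Σ_x e_{(xα,xα)} − a Σ_x e_{(xβ,xβ)}` is zero: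
`z′† G z′ = b² Tr γ_αα + a² Tr γ_ββ + b² Tr Γ_αα + a² Tr Γ_ββ − 2ab Tr Γ_αβ = 0`. -/
theorem sectorVec_dotProduct_gMap_mulVec_sectorVec_eq_zero {a b : ℕ}
    {γ : Matrix (Orb Λ) (Orb Λ) ℂ} {Γ : Matrix (Orb Λ × Orb Λ) (Orb Λ × Orb Λ) ℂ}
    (h : IsDQGFeasibleSector a b γ Γ) :
    star (fun J : Orb Λ × Orb Λ =>
        ∑ x : Λ, ((if J = (orb x 0, orb x 0) then (b : ℂ) else 0) -
          (if J = (orb x 1, orb x 1) then (a : ℂ) else 0))) ⬝ᵥ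
      (gMap γ Γ *ᵥ fun J : Orb Λ × Orb Λ =>
        ∑ x : Λ, ((if J = (orb x 0, orb x 0) then (b : ℂ) else 0) -
          (if J = (orb x 1, orb x 1) then (a : ℂ) else 0))) = 0 := by
  rw [star_sectorVec, sectorVec_dotProduct]
  -- the five sector trace rows, with antisymmetry moving `G`'s entries onto the block diagonals
  have h1 : ∑ x : Λ, γ (orb x 0) (orb x 0) = (a : ℂ) := h.trace_up
  have h2 : ∑ x : Λ, γ (orb x 1) (orb x 1) = (b : ℂ) := h.trace_down
  have h3 : ∑ x : Λ, ∑ y : Λ, Γ (orb x 0, orb y 0) (orb y 0, orb x 0) = -((a : ℂ) * ((a : ℂ) - 1)) := by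
    rw [sum_sum_swap_snd h.dqg.swap_snd (fun x => orb x 0) (fun y => orb y 0), h.trace_upUp]
  have h4 : ∑ x : Λ, ∑ y : Λ, Γ (orb x 1, orb y 1) (orb y 1, orb x 1) = -((b : ℂ) * ((b : ℂ) - 1)) := by
    rw [sum_sum_swap_snd h.dqg.swap_snd (fun x => orb x 1) (fun y => orb y 1), h.trace_downDown]
  have h5 : ∑ x : Λ, ∑ y : Λ, Γ (orb x 0, orb y 1) (orb y 1, orb x 0) = -((a : ℂ) * (b : ℂ)) := by
    rw [sum_sum_swap_snd h.dqg.swap_snd (fun x => orb x 0) (fun y => orb y 1), h.trace_upDown]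
  have h6 : ∑ x : Λ, ∑ y : Λ, Γ (orb x 1, orb y 0) (orb y 0, orb x 1) = -((a : ℂ) * (b : ℂ)) := by
    calc ∑ x : Λ, ∑ y : Λ, Γ (orb x 1, orb y 0) (orb y 0, orb x 1)
        = ∑ x : Λ, ∑ y : Λ, -Γ (orb y 0, orb x 1) (orb y 0, orb x 1) := by
          refine Finset.sum_congr rfl fun x _ => Finset.sum_congr rfl fun y _ => ?_
          exact h.dqg.swap_fst _ _ _
      _ = -((a : ℂ) * (b : ℂ)) := by
          simp only [Finset.sum_neg_distrib]
          rw [Finset.sum_comm, h.trace_upDown]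
  -- the per-orbital entries of `G z′`
  have hx : ∀ x : Λ,
      (b : ℂ) * (gMap γ Γ *ᵥ fun J : Orb Λ × Orb Λ =>
          ∑ x : Λ, ((if J = (orb x 0, orb x 0) then (b : ℂ) else 0) -
            (if J = (orb x 1, orb x 1) then (a : ℂ) else 0))) (orb x 0, orb x 0) -
        (a : ℂ) * (gMap γ Γ *ᵥ fun J : Orb Λ × Orb Λ =>
          ∑ x : Λ, ((if J = (orb x 0, orb x 0) then (b : ℂ) else 0) -
            (if J = (orb x 1, orb x 1) then (a : ℂ) else 0))) (orb x 1, orb x 1) =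
      (b : ℂ) * (b : ℂ) * γ (orb x 0) (orb x 0) + (a : ℂ) * (a : ℂ) * γ (orb x 1) (orb x 1) -
        (b : ℂ) * (b : ℂ) * ∑ y : Λ, Γ (orb x 0, orb y 0) (orb y 0, orb x 0) +
        (a : ℂ) * (b : ℂ) * ∑ y : Λ, Γ (orb x 0, orb y 1) (orb y 1, orb x 0) +
        (a : ℂ) * (b : ℂ) * ∑ y : Λ, Γ (orb x 1, orb y 0) (orb y 0, orb x 1) -
        (a : ℂ) * (a : ℂ) * ∑ y : Λ, Γ (orb x 1, orb y 1) (orb y 1, orb x 1) := by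
    intro x
    rw [gMap_mulVec_sectorVec_apply, gMap_mulVec_sectorVec_apply, sum_gMap_apply_diag,
      sum_gMap_apply_diag, sum_gMap_apply_diag, sum_gMap_apply_diag, if_pos rfl, if_pos rfl,
      if_neg (by decide), if_neg (by decide)]
    ring
  rw [Finset.sum_congr rfl fun x _ => hx x]
  simp only [Finset.sum_add_distrib, Finset.sum_sub_distrib, ← Finset.mul_sum]
  rw [h1, h2, h3, h4, h5, h6]
  ring

/-- **Theorem F3.2 (kernel part) = rdm-A's face F1 at RELAXATION level.** At every feasible point of
the printed `S_z`-sector DQG programme (not only at the reduced density matrices of a sector state)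
`G(γ, Γ) z′ = 0`: `G ⪰ 0` turns the zero quadratic form into a kernel vector. -/
theorem gMap_mulVec_sectorVec_eq_zero {a b : ℕ}
    {γ : Matrix (Orb Λ) (Orb Λ) ℂ} {Γ : Matrix (Orb Λ × Orb Λ) (Orb Λ × Orb Λ) ℂ}
    (h : IsDQGFeasibleSector a b γ Γ) :
    (gMap γ Γ *ᵥ fun J : Orb Λ × Orb Λ =>
        ∑ x : Λ, ((if J = (orb x 0, orb x 0) then (b : ℂ) else 0) -
          (if J = (orb x 1, orb x 1) then (a : ℂ) else 0))) = 0 :=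
  (h.dqg.g_psd.dotProduct_mulVec_zero_iff _).mp (sectorVec_dotProduct_gMap_mulVec_sectorVec_eq_zero h)

/-- The kernel rows, written out: for every row index `(P, qτ)`,
`b (δ_{τα} γ_{P,qτ} + Σ_x Γ_{(P,xα),(qτ,xα)}) − a (δ_{τβ} γ_{P,qτ} + Σ_x Γ_{(P,xβ),(qτ,xβ)}) = 0`. -/
theorem gMap_sectorKernel_row {a b : ℕ}
    {γ : Matrix (Orb Λ) (Orb Λ) ℂ} {Γ : Matrix (Orb Λ × Orb Λ) (Orb Λ × Orb Λ) ℂ}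
    (h : IsDQGFeasibleSector a b γ Γ) (P : Orb Λ) (q : Λ) (τ : Fin 2) :
    (b : ℂ) * ((if τ = 0 then γ P (orb q τ) else 0) + ∑ x : Λ, Γ (P, orb x 0) (orb q τ, orb x 0)) -
      (a : ℂ) * ((if τ = 1 then γ P (orb q τ) else 0) + ∑ x : Λ, Γ (P, orb x 1) (orb q τ, orb x 1)) =
        0 := by
  have h0 := congr_fun (gMap_mulVec_sectorVec_eq_zero h) (P, orb q τ)
  rw [Pi.zero_apply, gMap_mulVec_sectorVec_apply, sum_gMap_apply_diag, sum_gMap_apply_diag] at h0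
  have hs : ∀ σ : Fin 2, ∑ x : Λ, Γ (P, orb x σ) (orb x σ, orb q τ) =
      -∑ x : Λ, Γ (P, orb x σ) (orb q τ, orb x σ) := by
    intro σ
    rw [← Finset.sum_neg_distrib]
    exact Finset.sum_congr rfl fun x _ => h.dqg.swap_snd _ _ _
  rw [hs 0, hs 1, sub_neg_eq_add, sub_neg_eq_add] at h0
  exact h0

/-! ### F3.2, row part: the kernel rows solve to the cell's spin-resolved contraction rows E2 -/

/-- The spin-free contraction row (Mazziotti (2007) eq. (16)) split by the spin of the summed index. -/
theorem sum_two_up_add_sum_two_down {a b : ℕ}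
    {γ : Matrix (Orb Λ) (Orb Λ) ℂ} {Γ : Matrix (Orb Λ × Orb Λ) (Orb Λ × Orb Λ) ℂ}
    (h : IsDQGFeasibleSector a b γ Γ) (P Q : Orb Λ) :
    ∑ x : Λ, Γ (P, orb x 0) (Q, orb x 0) + ∑ x : Λ, Γ (P, orb x 1) (Q, orb x 1) =
      ((a : ℂ) + (b : ℂ) - 1) * γ P Q := by
  rw [← Finset.sum_add_distrib, ← sum_orb_eq (fun j => Γ (P, j) (Q, j)), h.dqg.contract P Q,
    Nat.cast_add]

/-- **E2, family `(σ, τ) = (α, α)`** — implied by the printed programme: for `a + b ≠ 0`,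
`Σ_y Γ_{(P, yα),(qα, yα)} = (N_α − 1) γ_{P, qα}` at every sector-feasible pair (FORMAT-qcl1 §5 E2 with
`P = pα`; the row also holds for `P = pβ`, where the right-hand side vanishes by the selection rule). -/
theorem sum_two_upUp_of_isDQGFeasibleSector {a b : ℕ}
    {γ : Matrix (Orb Λ) (Orb Λ) ℂ} {Γ : Matrix (Orb Λ × Orb Λ) (Orb Λ × Orb Λ) ℂ}
    (h : IsDQGFeasibleSector a b γ Γ) (hab : a + b ≠ 0) (P : Orb Λ) (q : Λ) :
    ∑ y : Λ, Γ (P, orb y 0) (orb q 0, orb y 0) = ((a : ℂ) - 1) * γ P (orb q 0) := by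
  have hk := gMap_sectorKernel_row h P q 0
  rw [if_pos rfl, if_neg (by decide), zero_add] at hk
  have hc := sum_two_up_add_sum_two_down h P (orb q 0)
  have hne : ((a : ℂ) + (b : ℂ)) ≠ 0 := by exact_mod_cast hab
  have key : ((a : ℂ) + (b : ℂ)) *
      (∑ y : Λ, Γ (P, orb y 0) (orb q 0, orb y 0) - ((a : ℂ) - 1) * γ P (orb q 0)) = 0 := by
    linear_combination hk + (a : ℂ) * hc
  exact sub_eq_zero.mp ((mul_eq_zero.mp key).resolve_left hne)

/-- **E2, family `(σ, τ) = (α, β)`**: `Σ_y Γ_{(P, yβ),(qα, yβ)} = N_β γ_{P, qα}` (FORMAT-qcl1 §5 E2). -/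
theorem sum_two_upDown_of_isDQGFeasibleSector {a b : ℕ}
    {γ : Matrix (Orb Λ) (Orb Λ) ℂ} {Γ : Matrix (Orb Λ × Orb Λ) (Orb Λ × Orb Λ) ℂ}
    (h : IsDQGFeasibleSector a b γ Γ) (hab : a + b ≠ 0) (P : Orb Λ) (q : Λ) :
    ∑ y : Λ, Γ (P, orb y 1) (orb q 0, orb y 1) = (b : ℂ) * γ P (orb q 0) := by
  have hc := sum_two_up_add_sum_two_down h P (orb q 0)
  rw [sum_two_upUp_of_isDQGFeasibleSector h hab P q] at hc
  linear_combination hc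

/-- **E2, family `(σ, τ) = (β, β)`**: `Σ_y Γ_{(P, yβ),(qβ, yβ)} = (N_β − 1) γ_{P, qβ}` (FORMAT §5 E2). -/
theorem sum_two_downDown_of_isDQGFeasibleSector {a b : ℕ}
    {γ : Matrix (Orb Λ) (Orb Λ) ℂ} {Γ : Matrix (Orb Λ × Orb Λ) (Orb Λ × Orb Λ) ℂ}
    (h : IsDQGFeasibleSector a b γ Γ) (hab : a + b ≠ 0) (P : Orb Λ) (q : Λ) :
    ∑ y : Λ, Γ (P, orb y 1) (orb q 1, orb y 1) = ((b : ℂ) - 1) * γ P (orb q 1) := by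
  have hk := gMap_sectorKernel_row h P q 1
  rw [if_neg (by decide), if_pos rfl, zero_add] at hk
  have hc := sum_two_up_add_sum_two_down h P (orb q 1)
  have hne : ((a : ℂ) + (b : ℂ)) ≠ 0 := by exact_mod_cast hab
  have key : ((a : ℂ) + (b : ℂ)) *
      (∑ y : Λ, Γ (P, orb y 1) (orb q 1, orb y 1) - ((b : ℂ) - 1) * γ P (orb q 1)) = 0 := by
    linear_combination (b : ℂ) * hc - hk
  exact sub_eq_zero.mp ((mul_eq_zero.mp key).resolve_left hne)

/-- **E2, family `(σ, τ) = (β, α)`**: `Σ_y Γ_{(P, yα),(qβ, yα)} = N_α γ_{P, qβ}` (FORMAT-qcl1 §5 E2). -/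
theorem sum_two_downUp_of_isDQGFeasibleSector {a b : ℕ}
    {γ : Matrix (Orb Λ) (Orb Λ) ℂ} {Γ : Matrix (Orb Λ × Orb Λ) (Orb Λ × Orb Λ) ℂ}
    (h : IsDQGFeasibleSector a b γ Γ) (hab : a + b ≠ 0) (P : Orb Λ) (q : Λ) :
    ∑ y : Λ, Γ (P, orb y 0) (orb q 1, orb y 0) = (a : ℂ) * γ P (orb q 1) := by
  have hc := sum_two_up_add_sum_two_down h P (orb q 1)
  rw [sum_two_downDown_of_isDQGFeasibleSector h hab P q] at hc
  linear_combination hc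

/-! ### The converse, the equality of the two feasible sets, and the cell-row lower bound -/

/-- **The cell's row set implies the printed one.** DQG feasibility at `N = a + b`, the `S_z` selection
rule, the two spin traces E1 and the E2 families `(α,α)`, `(α,β)`, `(β,β)` (FORMAT-qcl1 §5, row labels
`pσ, qσ`) give the printed block-trace rows (Mazziotti 2007 eqs. (87)–(90)) by summing the `p = q`
rows over `p`. -/
theorem isDQGFeasibleSector_of_spinContract {a b : ℕ}
    {γ : Matrix (Orb Λ) (Orb Λ) ℂ} {Γ : Matrix (Orb Λ × Orb Λ) (Orb Λ × Orb Λ) ℂ}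
    (hdqg : IsDQGFeasible (a + b) γ Γ)
    (hsel : ∀ p q : Λ, ∀ σ τ : Fin 2, σ ≠ τ → γ (orb p σ) (orb q τ) = 0)
    (hup : ∑ x : Λ, γ (orb x 0) (orb x 0) = a) (hdown : ∑ x : Λ, γ (orb x 1) (orb x 1) = b)
    (hE2aa : ∀ p q : Λ,
      ∑ y : Λ, Γ (orb p 0, orb y 0) (orb q 0, orb y 0) = ((a : ℂ) - 1) * γ (orb p 0) (orb q 0))
    (hE2ab : ∀ p q : Λ,
      ∑ y : Λ, Γ (orb p 0, orb y 1) (orb q 0, orb y 1) = (b : ℂ) * γ (orb p 0) (orb q 0))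
    (hE2bb : ∀ p q : Λ,
      ∑ y : Λ, Γ (orb p 1, orb y 1) (orb q 1, orb y 1) = ((b : ℂ) - 1) * γ (orb p 1) (orb q 1)) :
    IsDQGFeasibleSector a b γ Γ where
  dqg := hdqg
  spin_sel := hsel
  trace_up := hup
  trace_down := hdown
  trace_upUp := by
    rw [Finset.sum_congr rfl fun x _ => hE2aa x x, ← Finset.mul_sum, hup, mul_comm]
  trace_downDown := by
    rw [Finset.sum_congr rfl fun x _ => hE2bb x x, ← Finset.mul_sum, hdown, mul_comm]
  trace_upDown := by
    rw [Finset.sum_congr rfl fun x _ => hE2ab x x, ← Finset.mul_sum, hup, mul_comm]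

/-- **The two row sets cut out the same feasible set (addendum 18 §18.4, DQG rung, `G` part).** For a
sector with `a + b ≠ 0`, a pair is feasible for the PRINTED `S_z`-sector DQG programme iff it is DQG
feasible at `N = a + b` with the `S_z` selection rule, the two spin traces E1 and the four families of
spin-resolved contraction rows E2 of the cell's qcl1 instances (FORMAT-qcl1 §5; FORMAT emits the
`p ≤ q` half, the `(q, p)` row being the conjugate of the `(p, q)` row under the Hermiticity rows).
Hence, in exact arithmetic and at the level of these predicates, the two programmes have the same
optimal value for every objective. -/
theorem isDQGFeasibleSector_iff_spinContract {a b : ℕ} (hab : a + b ≠ 0)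
    (γ : Matrix (Orb Λ) (Orb Λ) ℂ) (Γ : Matrix (Orb Λ × Orb Λ) (Orb Λ × Orb Λ) ℂ) :
    IsDQGFeasibleSector a b γ Γ ↔
      IsDQGFeasible (a + b) γ Γ ∧
        (∀ p q : Λ, ∀ σ τ : Fin 2, σ ≠ τ → γ (orb p σ) (orb q τ) = 0) ∧
        ∑ x : Λ, γ (orb x 0) (orb x 0) = a ∧ ∑ x : Λ, γ (orb x 1) (orb x 1) = b ∧
        (∀ p q : Λ,
          ∑ y : Λ, Γ (orb p 0, orb y 0) (orb q 0, orb y 0) = ((a : ℂ) - 1) * γ (orb p 0) (orb q 0)) ∧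
        (∀ p q : Λ,
          ∑ y : Λ, Γ (orb p 0, orb y 1) (orb q 0, orb y 1) = (b : ℂ) * γ (orb p 0) (orb q 0)) ∧
        (∀ p q : Λ,
          ∑ y : Λ, Γ (orb p 1, orb y 1) (orb q 1, orb y 1) = ((b : ℂ) - 1) * γ (orb p 1) (orb q 1)) ∧
        (∀ p q : Λ,
          ∑ y : Λ, Γ (orb p 1, orb y 0) (orb q 1, orb y 0) = (a : ℂ) * γ (orb p 1) (orb q 1)) :=
  ⟨fun h => ⟨h.dqg, h.spin_sel, h.trace_up, h.trace_down,
      fun p q => sum_two_upUp_of_isDQGFeasibleSector h hab (orb p 0) q,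
      fun p q => sum_two_upDown_of_isDQGFeasibleSector h hab (orb p 0) q,
      fun p q => sum_two_downDown_of_isDQGFeasibleSector h hab (orb p 1) q,
      fun p q => sum_two_downUp_of_isDQGFeasibleSector h hab (orb p 1) q⟩,
    fun ⟨hdqg, hsel, hup, hdown, haa, hab', hbb, _⟩ =>
      isDQGFeasibleSector_of_spinContract hdqg hsel hup hdown haa hab' hbb⟩

/-- **The variational lower bound in the cell's row form (every sector).** For Hermitian integral data
and `a, b ≤ |Λ|`: if `c` lies below the energy functional on every pair that is DQG feasible at
`N = a + b` and satisfies the `S_z` selection rule, the spin traces E1 and the four E2 families, then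
`c ≤ E₀(Ĥ; N_α = a, N_β = b)`. No `a + b ≠ 0` here: the reduced density matrices of the sector
ground state satisfy E2 directly (tree `sum_twoRDM_orb_up`, `sum_twoRDM_orb_down`). Companion of
`le_sectorGroundEnergy_of_forall_isDQGFeasibleSector`. -/
theorem le_sectorGroundEnergy_of_forall_spinContract {h : Λ → Λ → ℂ} {g : Λ → Λ → Λ → Λ → ℂ}
    {hnuc : ℂ} (hH : (molecularHamiltonian h g hnuc).IsHermitian) {a b : ℕ}
    (ha : a ≤ Fintype.card Λ) (hb : b ≤ Fintype.card Λ) {c : ℝ}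
    (hc : ∀ γ Γ, IsDQGFeasible (a + b) γ Γ →
      (∀ p q : Λ, ∀ σ τ : Fin 2, σ ≠ τ → γ (orb p σ) (orb q τ) = 0) →
      ∑ x : Λ, γ (orb x 0) (orb x 0) = a → ∑ x : Λ, γ (orb x 1) (orb x 1) = b →
      (∀ p q : Λ,
        ∑ y : Λ, Γ (orb p 0, orb y 0) (orb q 0, orb y 0) = ((a : ℂ) - 1) * γ (orb p 0) (orb q 0)) →
      (∀ p q : Λ,
        ∑ y : Λ, Γ (orb p 0, orb y 1) (orb q 0, orb y 1) = (b : ℂ) * γ (orb p 0) (orb q 0)) →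
      (∀ p q : Λ,
        ∑ y : Λ, Γ (orb p 1, orb y 1) (orb q 1, orb y 1) = ((b : ℂ) - 1) * γ (orb p 1) (orb q 1)) →
      (∀ p q : Λ,
        ∑ y : Λ, Γ (orb p 1, orb y 0) (orb q 1, orb y 0) = (a : ℂ) * γ (orb p 1) (orb q 1)) →
      c ≤ (rdmEnergy h g hnuc γ Γ).re) :
    c ≤ sectorGroundEnergy (molecularHamiltonian h g hnuc) a b := by
  obtain ⟨ψ, hψ, hψ1, hHψ⟩ := exists_unit_eigen_sectorGroundEnergy hH ha hb
  have hS := IsDQGFeasibleSector.of_state hψ hψ1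
  have hE := hc _ _ hS.dqg hS.spin_sel hS.trace_up hS.trace_down
    (fun p q => by rw [sum_twoRDM_orb_up hψ, if_pos rfl])
    (fun p q => by rw [sum_twoRDM_orb_down hψ, if_neg (by decide), sub_zero])
    (fun p q => by rw [sum_twoRDM_orb_down hψ, if_pos rfl])
    (fun p q => by rw [sum_twoRDM_orb_up hψ, if_neg (by decide), sub_zero])
  rw [rdmEnergy_rdm h g hnuc hψ1, hHψ, dotProduct_smul, hψ1, smul_eq_mul, mul_one,
    Complex.ofReal_re] at hE
  exact hE

end Summit.Ventures.CertifiedQuantumChemistry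

end
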